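import Summits.QuantumFields.YangMills.Theorems.BalabanUVNodesN21GappedTopCut13CoPHCount
import Summits.QuantumFields.YangMills.Theorems.BalabanUVNodesN21ShellSplitOfRecord13CoPHStat

/-!
# N21 (NE7c) · THE GAPPED TOP CUT WITHOUT THE SIGN ROW: at NONPOSITIVE letters every (2.17) cube test FAILS (every top cube has a plaquette, g9 FILE 6 `plaqInside_cubeEnl_nonempty`),
# so the gapped weights ARE the one-letter weights and the two-sided collar shell VANISHES — hence the pigeonhole and the common depth hold along the grid `θ_i = ε(1−ρ)^i` for
# EITHER SIGN of `ε` (junk couplings included), with the dial row `0 ≤ ρ ≤ 1` only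

R134 seat `pub-ymgap-dag-n21-d` (g11), node N21 = NE7c (NOT PRINTED; NOT proved at print's fixed thresholds), strategy s2; lane K3⁷ `SpineGivenEndpointR13SepCoPH`
(stmt-QuantumFields-20544, `--supports … --as helper`; COUNT-NEUTRAL).  Imports U3 `…GappedTopCut13CoPHCount` (p619723 ✓; through it U1∕U2) and g9 FILE 6 `…ShellSplitOfRecord13CoPHStat`
(p597562 ✓: `plaqInside_cubeEnl_nonempty` — torus geometry, COUNTED).  Why: U2∕U3 display `0 ≤ ε_{k+1}` (the meaningful regime of the couplings) to order the grid; the K3 skeleton's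
`KeyedShellWeight` quantifies over EVERY bare sequence `g₀`, junk included.  At `ε < 0` the grid is nonpositive and the shells are identically `0` — so the row can be DROPPED.

WHAT THIS FILE PROVES (theorems only; 0 `def`).
* §43 NONPOSITIVE LETTERS: `chiFactorAt_eq_zero_of_nonpos` (`θ ≤ 0 ⇒ χf^{θ}_c ≡ 0`: `dist1 ≥ 0`, the plaquette family of a cube is nonempty), `aGapAt_eq_aWeightAt_of_nonpos`,
  `chiSeqOfRecordAt_succ_eq_of_nonpos`, `wGapAt_eq_wTopAt_of_nonpos` (at the top), ★ `topGapShellAt_eq_zero_of_nonpos`.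
* §44 SIGN-FREE along the grid (`0 ≤ ρ ≤ 1`, any `ε`): ★ `topGapShellAt_cutGrid_nonneg`, ★★★ `sum_range_sum_topGapShell_le'`, ★★★ `exists_common_depth_topGapShell_le'` — U2∕U3's statements
  with the hypothesis `0 ≤ epsOfRecord ν g (k + 1)` REMOVED (case `0 ≤ ε`: U2∕U3; case `ε < 0`: every shell vanishes).

HONEST FRAMING (binding).  [folklore] bookkeeping; NO estimate of Bałaban's; the junk regime `ε < 0` is a degenerate instance (all top cube tests fail), treated only so that
the displayed rows shrink to the dial row; NE7c NOT PRINTED ∕ NOT proved at print's thresholds; N21 NOT discharged; K3⁷ NOT claimed; counts UNMOVED (typed 28∕28 · discharged 5∕27);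
never a count claim.  No `instance`, no `notation`, no `def`.  One finite four-torus programme at fixed `ε` — NOT ℝ⁴, NOT OS, NOT a mass gap, NOT the Clay problem.
-/

noncomputable section

open scoped BigOperators
open Finset MeasureTheory

namespace Summit.QuantumFields.YangMills.Theorems.N21ShellSplitOfRecord13CoPH

open Literature.MathematicalPhysics.QuantumFieldTheory.Balaban1983to89
open Literature.MathematicalPhysics.QuantumFieldTheory.Balaban1983to89.T4Continuum
open Literature.MathematicalPhysics.QuantumFieldTheory.Balaban1983to89.Node00
open Summit.QuantumFields.YangMills.BalabanUVNodes.N19MGFRoadLiveSelectorTower (dressedSlotsOfDatum₉_nonneg)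
open Summit.QuantumFields.YangMills.BalabanUVNodes.N19MGFFormAtRecord (wOfRecord₉_nonneg)

/-! ## §43 Nonpositive letters: every top cube test fails, the gapped objects collapse onto the one-letter objects, the shell vanishes -/

section Nonpos

variable (F : T4Family) (N : ℕ) [NeZero N] (ϑ : Stage9Params F N) (D : FiniteEpsData F (SU N)) (g₀ : ℕ → ℝ) (os : List (ULoop F))
  (p : B12.RunParams) (g : ℕ → ℝ) (k : ℕ)

/-- **AT A NONPOSITIVE LETTER EVERY (2.17) CUBE TEST FAILS**: `θ ≤ 0 ⇒ χf^{θ}_c(V′) = 0` — the test asks `|U(∂p) − 1| < θ·η² ≤ 0` of every plaquette `p ⊂ c^∼`, and there is one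
(g9 `plaqInside_cubeEnl_nonempty`; `dist1 ≥ 0`). [bookkeeping] -/
theorem chiFactorAt_eq_zero_of_nonpos {θ : ℝ} (hθ : θ ≤ 0) (c : Iχ F ϑ.ν p g k) (V' : GaugeField (F.P p.K) (k + 1) (SU N)) :
    chiFactorAt F N ϑ.ν p g k θ c V' = 0 := by
  obtain ⟨q, hq⟩ := plaqInside_cubeEnl_nonempty F ϑ.ν g p.K (k + 1) c
  unfold chiFactorAt chiSmall
  rw [if_neg]
  intro h
  have h1 := h q hq
  have h2 : θ * (F.P p.K).eta (k + 1) ^ 2 ≤ 0 := mul_nonpos_of_nonpos_of_nonneg hθ (sq_nonneg _)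
  exact absurd (lt_of_lt_of_le h1 h2) (not_lt.2 (GaugeGroup.dist1_nonneg _))

/-- at nonpositive letters the GAPPED (3.2) weight IS the one-letter weight (both read «`P` is the whole (3.2) range»). [bookkeeping] -/
theorem aGapAt_eq_aWeightAt_of_nonpos {θlo θ θhi : ℝ} (hlo : θlo ≤ 0) (hθ : θ ≤ 0) (hhi : θhi ≤ 0) (s : SeqOfRecord F ϑ.ν ϑ.τ9.M g p.K k)
    (Pl : Finset (Iχ F ϑ.ν p g k)) (V' : GaugeField (F.P p.K) (k + 1) (SU N)) :
    aGapAt F N ϑ.ν ϑ.τ9.M p g k θlo θhi s Pl V' = aWeightAt F N ϑ.ν ϑ.τ9.M p g k θ s Pl V' := by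
  by_cases hP : Pl ⊆ cubes32 F ϑ.ν ϑ.τ9.M p g k s
  · have h1 : ∏ c ∈ cubes32 F ϑ.ν ϑ.τ9.M p g k s \ Pl, chiFactorAt F N ϑ.ν p g k θlo c V' =
        ∏ c ∈ cubes32 F ϑ.ν ϑ.τ9.M p g k s \ Pl, chiFactorAt F N ϑ.ν p g k θ c V' :=
      Finset.prod_congr rfl fun c _ => by
        rw [chiFactorAt_eq_zero_of_nonpos F N ϑ p g k hlo c V', chiFactorAt_eq_zero_of_nonpos F N ϑ p g k hθ c V']
    have h2 : ∏ c ∈ Pl, (1 - chiFactorAt F N ϑ.ν p g k θhi c V') = ∏ c ∈ Pl, (1 - chiFactorAt F N ϑ.ν p g k θ c V') :=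
      Finset.prod_congr rfl fun c _ => by
        rw [chiFactorAt_eq_zero_of_nonpos F N ϑ p g k hhi c V', chiFactorAt_eq_zero_of_nonpos F N ϑ p g k hθ c V']
    rw [aGapAt_of_subset F N ϑ.ν ϑ.τ9.M p g k θlo θhi s hP, aWeightAt_of_subset F N ϑ.ν ϑ.τ9.M p g k θ s hP, h1, h2]
  · rw [aGapAt_of_not_subset F N ϑ.ν ϑ.τ9.M p g k θlo θhi s hP, aWeightAt, if_neg hP]

/-- at nonpositive letters the front factors one step up coincide (every factor is `0`; the product reads «`Ω_{k+1}` has no cube»). [bookkeeping] -/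
theorem chiSeqOfRecordAt_succ_eq_of_nonpos {θ' θ : ℝ} (hθ' : θ' ≤ 0) (hθ : θ ≤ 0) (s' : SeqOfRecord F ϑ.ν ϑ.τ9.M g p.K (k + 1)) (V' : GaugeField (F.P p.K) (k + 1) (SU N)) :
    chiSeqOfRecordAt F N ϑ.ν ϑ.τ9.M g p.K (k + 1) θ' s' V' = chiSeqOfRecordAt F N ϑ.ν ϑ.τ9.M g p.K (k + 1) θ s' V' := by
  rw [chiSeqOfRecordAt_eq_prod_cubeChiAt, chiSeqOfRecordAt_eq_prod_cubeChiAt]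
  refine Finset.prod_congr rfl fun a _ => ?_
  show chiFactorAt F N ϑ.ν p g k θ' a V' = chiFactorAt F N ϑ.ν p g k θ a V'
  rw [chiFactorAt_eq_zero_of_nonpos F N ϑ p g k hθ' a V', chiFactorAt_eq_zero_of_nonpos F N ϑ p g k hθ a V']

/-- at nonpositive letters and at the run's top the GAPPED step weights ARE T1's top-lettered step weights. [bookkeeping] -/
theorem wGapAt_eq_wTopAt_of_nonpos (hk : k + 1 = p.K) {θlo θ θhi : ℝ} (hlo : θlo ≤ 0) (hθ : θ ≤ 0) (hhi : θhi ≤ 0)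
    (s' : SeqOfRecord F ϑ.ν ϑ.τ9.M g p.K (k + 1)) (U : GaugeField (F.P p.K) k (SU N)) (V' : GaugeField (F.P p.K) (k + 1) (SU N)) :
    wGapAt F N ϑ θlo θhi p g k s' U V' = wTopAt F N ϑ θ p g k s' U V' := by
  classical
  have htop : topLetter ϑ.ν θ p g (k + 1) = θ := by rw [hk]; exact topLetter_top ϑ.ν θ p g
  rw [wGapAt_apply, wTopAt_apply, htop]
  unfold resumWeights
  refine Finset.sum_congr rfl fun t _ => ?_
  unfold ωGapAt ωOfRecordAt
  rw [aGapAt_eq_aWeightAt_of_nonpos F N ϑ p g k hlo hθ hhi]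

/-- ★ **AT NONPOSITIVE LETTERS THE TWO-SIDED COLLAR SHELL VANISHES** (at the run's top): the gapped core IS the term. [bookkeeping] -/
theorem topGapShellAt_eq_zero_of_nonpos (hk : k + 1 = p.K) {θlo θ θhi : ℝ} (hlo : θlo ≤ 0) (hθ : θ ≤ 0) (hhi : θhi ≤ 0) (t : ℝ)
    (s' : SeqOfRecord F ϑ.ν ϑ.τ9.M g p.K (k + 1)) : topGapShellAt F N ϑ D g₀ os p g k θlo θ θhi t s' = 0 := by
  have hk' : k < p.K := by omega
  unfold topGapShellAt topGapCoreAt topClassWeightAt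
  rw [sub_eq_zero]
  refine integral_congr_ae (ae_of_all _ fun V => ?_)
  dsimp only
  rw [chiSeqOfRecordAt_succ_eq_of_nonpos F N ϑ p g k hlo hθ s' V, topGapSlotAt_apply, topSlotAt_apply,
    chiSeqOfRecordAt_topLetter_of_lt F N ϑ p g k hk' θlo, chiSeqOfRecordAt_topLetter_of_lt F N ϑ p g k hk' θ]
  have hw : (fun U => wGapAt F N ϑ θlo θhi p g k s' U V *
        (chiSeqOfRecord F N ϑ.ν ϑ.τ9.M g p.K k s'.init U * dressedSlotsOfDatum₉ F N ϑ D g₀ os t p g k s'.init U)) =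
      (fun U => wTopAt F N ϑ θ p g k s' U V *
        (chiSeqOfRecord F N ϑ.ν ϑ.τ9.M g p.K k s'.init U * dressedSlotsOfDatum₉ F N ϑ D g₀ os t p g k s'.init U)) :=
    funext fun U => by rw [wGapAt_eq_wTopAt_of_nonpos F N ϑ p g k hk hlo hθ hhi s' U V]
  rw [hw]

end Nonpos

/-! ## §44 Sign-free along the grid: `0 ≤ ρ ≤ 1`, ANY sign of `ε` -/

section SignFree

variable (F : T4Family) (N : ℕ) [NeZero N] (ϑ : Stage9Params F N) (D : FiniteEpsData F (SU N)) (g₀ : ℕ → ℝ) (os : List (ULoop F))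

variable {F N ϑ D g₀ os} in
/-- along the grid with a NEGATIVE base every letter is nonpositive (`ρ ≤ 1`). [bookkeeping] -/
theorem cutGrid_nonpos_of_neg {ν : Stage7Numerics} {g : ℕ → ℝ} {j : ℕ} (hε : epsOfRecord ν g j < 0) {ρ : ℝ} (hρ1 : ρ ≤ 1) (i : ℕ) :
    cutGrid ν g j ρ i ≤ 0 := by
  unfold cutGrid
  exact mul_nonpos_of_nonpos_of_nonneg hε.le (pow_nonneg (by linarith) i)

/-- ★ **`0 ≤` THE TWO-SIDED COLLAR SHELL ALONG THE GRID, ANY SIGN OF `ε`** (`0 ≤ ρ ≤ 1`; rows `0 ≤ ζ`, `Σ|ζ| ≤ 1`, (H-ζ), (e1) at level `k`): for `0 ≤ ε` the letters are ordered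
(U2 `topGapShellAt_nonneg`); for `ε < 0` the shell is `0` (§43). [bookkeeping] -/
theorem topGapShellAt_cutGrid_nonneg (p : B12.RunParams) (g : ℕ → ℝ) (k : ℕ) (hk : k + 1 = p.K)
    (hζ0 : ∀ p g k s Pl Ql RS U V', 0 ≤ ϑ.ζ p g k s Pl Ql RS U V') (hζm : ZetaMeasurable F N ϑ.ζ) (hζ1 : IsZetaAbsLeOne F N ϑ.ν ϑ.τ9.M ϑ.ζ)
    {ρ : ℝ} (hρ0 : 0 ≤ ρ) (hρ1 : ρ ≤ 1) (i : ℕ) (t : ℝ)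
    (hint : ∀ s : SeqOfRecord F ϑ.ν ϑ.τ9.M g p.K k,
      Integrable (fun U => chiSeqOfRecord F N ϑ.ν ϑ.τ9.M g p.K k s U * dressedSlotsOfDatum₉ F N ϑ D g₀ os t p g k s U) (fieldMeasure (F.P p.K) k (SU N)))
    (s' : SeqOfRecord F ϑ.ν ϑ.τ9.M g p.K (k + 1)) :
    0 ≤ topGapShellAt F N ϑ D g₀ os p g k (cutGrid ϑ.ν g (k + 1) ρ (i + 2)) (cutGrid ϑ.ν g (k + 1) ρ (i + 1)) (cutGrid ϑ.ν g (k + 1) ρ i) t s' := by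
  rcases le_or_gt 0 (epsOfRecord ϑ.ν g (k + 1)) with hε | hε
  · exact topGapShellAt_nonneg F N ϑ D g₀ os p g k hk hζ0 hζm hζ1 (cutGrid_succ_le_of_nonneg ϑ.ν (k + 1) hε hρ0 hρ1 (i + 1))
      (cutGrid_succ_le_of_nonneg ϑ.ν (k + 1) hε hρ0 hρ1 i) t hint s'
  · rw [topGapShellAt_eq_zero_of_nonpos F N ϑ D g₀ os p g k hk (cutGrid_nonpos_of_neg hε hρ1 _) (cutGrid_nonpos_of_neg hε hρ1 _)
      (cutGrid_nonpos_of_neg hε hρ1 _) t s']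

/-- ★★★ **THE TWO-SIDED PIGEONHOLE, ANY SIGN OF `ε`** — U3's `sum_range_sum_topGapShell_le` with the row `0 ≤ ε_{k+1}` REMOVED (`ε < 0`: every shell vanishes and the right side is
`≥ 0`). [bookkeeping] -/
theorem sum_range_sum_topGapShell_le' (p : B12.RunParams) (g : ℕ → ℝ) (k : ℕ) (hk : k + 1 = p.K)
    (hζ0 : ∀ p g k s Pl Ql RS U V', 0 ≤ ϑ.ζ p g k s Pl Ql RS U V') (hζm : ZetaMeasurable F N ϑ.ζ) (hζ1 : IsZetaAbsLeOne F N ϑ.ν ϑ.τ9.M ϑ.ζ)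
    (hζu : IsZetaUnity F N ϑ.ν ϑ.τ9.M ϑ.ζ) {ρ : ℝ} (hρ0 : 0 ≤ ρ) (hρ1 : ρ ≤ 1) (m : ℕ) (t : ℝ)
    (hint : ∀ s : SeqOfRecord F ϑ.ν ϑ.τ9.M g p.K k,
      Integrable (fun U => chiSeqOfRecord F N ϑ.ν ϑ.τ9.M g p.K k s U * dressedSlotsOfDatum₉ F N ϑ D g₀ os t p g k s U) (fieldMeasure (F.P p.K) k (SU N))) :
    ∑ i ∈ Finset.range m, ∑ s', topGapShellAt F N ϑ D g₀ os p g k (cutGrid ϑ.ν g (k + 1) ρ (i + 2)) (cutGrid ϑ.ν g (k + 1) ρ (i + 1))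
        (cutGrid ϑ.ν g (k + 1) ρ i) t s' ≤
      2 * (2 * (F.L : ℝ) ^ F.m) ^ 4 * ∑ s, classWeightOfDatum₉ F N ϑ D g₀ os p g k t s := by
  rcases le_or_gt 0 (epsOfRecord ϑ.ν g (k + 1)) with hε | hε
  · exact sum_range_sum_topGapShell_le F N ϑ D g₀ os p g k hk hζ0 hζm hζ1 hζu hε hρ0 hρ1 m t hint
  · have h0 : ∀ i s', topGapShellAt F N ϑ D g₀ os p g k (cutGrid ϑ.ν g (k + 1) ρ (i + 2)) (cutGrid ϑ.ν g (k + 1) ρ (i + 1))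
        (cutGrid ϑ.ν g (k + 1) ρ i) t s' = 0 := fun i s' =>
      topGapShellAt_eq_zero_of_nonpos F N ϑ D g₀ os p g k hk (cutGrid_nonpos_of_neg hε hρ1 _) (cutGrid_nonpos_of_neg hε hρ1 _)
        (cutGrid_nonpos_of_neg hε hρ1 _) t s'
    simp only [h0, Finset.sum_const_zero]
    exact mul_nonneg (by positivity) (Finset.sum_nonneg fun s _ =>
      classWeightOfDatum₉_nonneg' F N ϑ D g₀ os p g k (wOfRecord₉_nonneg ϑ hζ0 p g) t s)

/-- ★★★ **TWO RUNS, ONE COMMON DEPTH, ANY SIGNS OF THE TWO `ε`'s** — U3's `exists_common_depth_topGapShell_le` with both sign rows REMOVED. [bookkeeping] -/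
theorem exists_common_depth_topGapShell_le' (p₁ : B12.RunParams) (g₁ : ℕ → ℝ) (k₁ : ℕ) (hk₁ : k₁ + 1 = p₁.K) (p₂ : B12.RunParams) (g₂ : ℕ → ℝ) (k₂ : ℕ)
    (hk₂ : k₂ + 1 = p₂.K)
    (hζ0 : ∀ p g k s Pl Ql RS U V', 0 ≤ ϑ.ζ p g k s Pl Ql RS U V') (hζm : ZetaMeasurable F N ϑ.ζ) (hζ1 : IsZetaAbsLeOne F N ϑ.ν ϑ.τ9.M ϑ.ζ)
    (hζu : IsZetaUnity F N ϑ.ν ϑ.τ9.M ϑ.ζ) {ρ : ℝ} (hρ0 : 0 ≤ ρ) (hρ1 : ρ ≤ 1) (n : ℕ) (t : ℝ)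
    (hint₁ : ∀ s : SeqOfRecord F ϑ.ν ϑ.τ9.M g₁ p₁.K k₁,
      Integrable (fun U => chiSeqOfRecord F N ϑ.ν ϑ.τ9.M g₁ p₁.K k₁ s U * dressedSlotsOfDatum₉ F N ϑ D g₀ os t p₁ g₁ k₁ s U) (fieldMeasure (F.P p₁.K) k₁ (SU N)))
    (hint₂ : ∀ s : SeqOfRecord F ϑ.ν ϑ.τ9.M g₂ p₂.K k₂,
      Integrable (fun U => chiSeqOfRecord F N ϑ.ν ϑ.τ9.M g₂ p₂.K k₂ s U * dressedSlotsOfDatum₉ F N ϑ D g₀ os t p₂ g₂ k₂ s U) (fieldMeasure (F.P p₂.K) k₂ (SU N))) :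
    ∃ i ∈ Finset.range (n + 1),
      ∑ s', topGapShellAt F N ϑ D g₀ os p₁ g₁ k₁ (cutGrid ϑ.ν g₁ (k₁ + 1) ρ (i + 2)) (cutGrid ϑ.ν g₁ (k₁ + 1) ρ (i + 1)) (cutGrid ϑ.ν g₁ (k₁ + 1) ρ i) t s' ≤
          4 * (2 * (F.L : ℝ) ^ F.m) ^ 4 / (n + 1 : ℕ) * ∑ s, classWeightOfDatum₉ F N ϑ D g₀ os p₁ g₁ k₁ t s ∧
        ∑ s', topGapShellAt F N ϑ D g₀ os p₂ g₂ k₂ (cutGrid ϑ.ν g₂ (k₂ + 1) ρ (i + 2)) (cutGrid ϑ.ν g₂ (k₂ + 1) ρ (i + 1)) (cutGrid ϑ.ν g₂ (k₂ + 1) ρ i) t s' ≤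
          4 * (2 * (F.L : ℝ) ^ F.m) ^ 4 / (n + 1 : ℕ) * ∑ s, classWeightOfDatum₉ F N ϑ D g₀ os p₂ g₂ k₂ t s := by
  set f : ℕ → ℝ := fun i => ∑ s', topGapShellAt F N ϑ D g₀ os p₁ g₁ k₁ (cutGrid ϑ.ν g₁ (k₁ + 1) ρ (i + 2)) (cutGrid ϑ.ν g₁ (k₁ + 1) ρ (i + 1))
    (cutGrid ϑ.ν g₁ (k₁ + 1) ρ i) t s' with hf
  set f' : ℕ → ℝ := fun i => ∑ s', topGapShellAt F N ϑ D g₀ os p₂ g₂ k₂ (cutGrid ϑ.ν g₂ (k₂ + 1) ρ (i + 2)) (cutGrid ϑ.ν g₂ (k₂ + 1) ρ (i + 1))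
    (cutGrid ϑ.ν g₂ (k₂ + 1) ρ i) t s' with hf'
  set S₁ : ℝ := ∑ s, classWeightOfDatum₉ F N ϑ D g₀ os p₁ g₁ k₁ t s with hS₁
  set S₂ : ℝ := ∑ s, classWeightOfDatum₉ F N ϑ D g₀ os p₂ g₂ k₂ t s with hS₂
  have hf0 : ∀ i, 0 ≤ f i := fun i => Finset.sum_nonneg fun s' _ =>
    topGapShellAt_cutGrid_nonneg F N ϑ D g₀ os p₁ g₁ k₁ hk₁ hζ0 hζm hζ1 hρ0 hρ1 i t hint₁ s'
  have hf'0 : ∀ i, 0 ≤ f' i := fun i => Finset.sum_nonneg fun s' _ =>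
    topGapShellAt_cutGrid_nonneg F N ϑ D g₀ os p₂ g₂ k₂ hk₂ hζ0 hζm hζ1 hρ0 hρ1 i t hint₂ s'
  have hw₁ : ∀ k s' U V', 0 ≤ wOfRecord₉ F N ϑ p₁ g₁ k s' U V' := wOfRecord₉_nonneg ϑ hζ0 p₁ g₁
  have hw₂ : ∀ k s' U V', 0 ≤ wOfRecord₉ F N ϑ p₂ g₂ k s' U V' := wOfRecord₉_nonneg ϑ hζ0 p₂ g₂
  have hS₁0 : 0 ≤ S₁ := Finset.sum_nonneg fun s _ => classWeightOfDatum₉_nonneg' F N ϑ D g₀ os p₁ g₁ k₁ hw₁ t s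
  have hS₂0 : 0 ≤ S₂ := Finset.sum_nonneg fun s _ => classWeightOfDatum₉_nonneg' F N ϑ D g₀ os p₂ g₂ k₂ hw₂ t s
  have hsum₁ : ∑ i ∈ Finset.range (n + 1), f i ≤ 2 * (2 * (F.L : ℝ) ^ F.m) ^ 4 * S₁ :=
    sum_range_sum_topGapShell_le' F N ϑ D g₀ os p₁ g₁ k₁ hk₁ hζ0 hζm hζ1 hζu hρ0 hρ1 (n + 1) t hint₁
  have hsum₂ : ∑ i ∈ Finset.range (n + 1), f' i ≤ 2 * (2 * (F.L : ℝ) ^ F.m) ^ 4 * S₂ :=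
    sum_range_sum_topGapShell_le' F N ϑ D g₀ os p₂ g₂ k₂ hk₂ hζ0 hζm hζ1 hζu hρ0 hρ1 (n + 1) t hint₂
  obtain ⟨i₀, hi₀, hmin⟩ := (Finset.range (n + 1)).exists_min_image (fun i => f i / S₁ + f' i / S₂) ⟨0, by simp⟩
  obtain ⟨h₁, h₂⟩ := argmin_badness_bounds hf0 hf'0 hS₁0 hS₂0 (by positivity) hsum₁ hsum₂ hi₀ hmin
  refine ⟨i₀, hi₀, ?_, ?_⟩
  · refine h₁.trans (le_of_eq ?_); ring
  · refine h₂.trans (le_of_eq ?_); ring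

end SignFree

end Summit.QuantumFields.YangMills.Theorems.N21ShellSplitOfRecord13CoPH

end
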